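import Summits.MatrixMultiplication.OmegaCensus.USPClassifyCert
import Summits.MatrixMultiplication.OmegaCensus.USPWidth3Maxima
import Mathlib.Data.List.Sort
import Mathlib.Data.List.Perm.Subperm
import Mathlib.Data.Fin.SuccPred
import HarnessLib

/-!
# ω-census, family (b′) STPP / USP: a slice-structured kernel certificate checker for "no 8-row USP of width 4" — I: the checker

HONEST FRAMING (pub-omega census; verbatim): lottery ticket; floor = certified bounds/negative ranges.
Census BOOKKEEPING machinery; no value of `ω` is touched here.  Continues the kit `USPClassifyKit/Refute/Cert.lean`.

The certificate behind `USPWidth4Maxima.lean` (`s_max^USP(4) ≤ 7`) is NOT an orderly-generation class table (that is ≈ 1.1 MB for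
the USP kind) but a depth-first search organised by the SLICES of column 3.  Write a width-4 puzzle as a list of codes
`x = r₀ + 3r₁ + 9r₂ + 27r₃ < 81` (`W4.codeOf`); slice `c` = the codes with `r₃ = c` = `[27c, 27c + 27)`.  Every slice of a USP, with its
constant column deleted, is a width-3 USP (`pt_deleteCol`), so has `≤ 4` rows (`IsUSP.card_le_four_of_width_three`, `USPWidth3Maxima`);
after a symmetry of `S₃ × S₄` an 8-row USP therefore has slice sizes `(n₀, n₁, n₂) ∈ {(4,4,0), (4,3,1), (4,2,2)}` or — when no column holds a
symbol 4 times — `(3,3,2)` with every column/symbol count `≤ 3` (the glue is in part II).  The search adds codes in increasing order, slice 0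
first (quota `n₀`), then slice 1 (quota `n₁`), then slice 2, and kills a candidate code `r` at the node with packed code list `P` by:
the PAIR TABLE (`GT`, a set bit means nothing, a clear bit `81a + b` is a tabulated non-USP pair, `goodTabOK`); the CAP rule (case
`(3,3,2)`: a fourth equal symbol in a column); Q6-MINIMALITY of the completed slice 0 (its code set has the least `msk` among its images under
the six column permutations fixing column 3 — part II moves any USP into that position); or an explicit 48-bit WITNESS `(σ, τ)` read from the
certificate stream (`refWP`/`validWit` of the kit).  Surviving candidates are descended into as the stream dictates (bit `1`); a node with 8
codes fails.  Soundness (`scan_sound`/`node_sound`): a passing run refutes every "completion" `codesOf P n ++ R` (`Rem`: `R` increasing, slice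
quotas) that would be a USP with the side conditions (`GoodE`).
-/

namespace Summit.MatrixMultiplication.OmegaCensus

open Literature.Computability.AlgebraicComplexity Equiv

namespace W4

/-! ## Tables and small numeric helpers -/

/-- Row `u` of the GOOD-pair table restricted to all 81 partner codes: bit `x` clear = `(u, x)` is a tabulated bad pair. [folklore] -/
def goodRow (GT u : ℕ) : ℕ := (GT >>> (81 * u)) &&& (2 ^ 81 - 1)

/-- The good-pair table is correct: a CLEAR bit `81a + b` only where `{a, b}` is no USP (`badPairB false`). [folklore] -/
def goodTabOK (GT : ℕ) : Bool :=
  (List.range 81).all fun a => (List.range 81).all fun b => GT.testBit (81 * a + b) || badPairB false a b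

/-- Reading the good-pair table. [folklore] -/
theorem bad_of_goodTab {GT a b : ℕ} (h : goodTabOK GT = true) (ha : a < 81) (hb : b < 81)
    (hab : GT.testBit (81 * a + b) = false) : badPairB false a b = true := by
  simp only [goodTabOK, List.all_eq_true, List.mem_range, Bool.or_eq_true] at h
  rcases h a ha b hb with h' | h'
  · rw [hab] at h'; exact absurd h' (by decide)
  · exact h'

/-- Number of codes among the first `n` of the packed list `P` whose digit `i` is `d`. [folklore] -/
def cntP (P i d : ℕ) : ℕ → ℕ
  | 0 => 0
  | u + 1 => cntP P i d u + (if dg (cd P u) i = d then 1 else 0)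

/-- `cntP` is `countP` on the decoded list. [folklore] -/
theorem cntP_eq (P i d : ℕ) : ∀ n, cntP P i d n = (codesOf P n).countP (fun x => dg x i == d)
  | 0 => by simp [cntP, codesOf]
  | n + 1 => by
    have e : codesOf P (n + 1) = codesOf P n ++ [cd P n] := by simp [codesOf, List.range_succ]
    rw [cntP, cntP_eq P i d n, e, List.countP_append]
    simp

/-- CAP violation: adding code `r` to the `n` codes of `P` makes some column `i < 3` carry the symbol `rᵢ` four times. [folklore] -/
def capViol (P n r : ℕ) : Bool :=
  decide (3 ≤ cntP P 0 (dg r 0) n) || decide (3 ≤ cntP P 1 (dg r 1) n) || decide (3 ≤ cntP P 2 (dg r 2) n)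

/-- The six column permutations fixing column 3 (indices `q` into `colTab`: `(0,1,2,3), (0,2,1,3), (1,0,2,3), (1,2,0,3), (2,0,1,3), (2,1,0,3)`).
[folklore] -/
def q6 : List ℕ := [0, 2, 6, 8, 12, 14]

/-- An order-free numeric key of a code list (the sum of `2^x`; for distinct codes it is the bit mask). [folklore] -/
def msk (L : List ℕ) : ℕ := (L.map fun x => 2 ^ x).sum

/-- Q6-minimality of a code list: its key is `≤` the key of each of its six images. [folklore] -/
def minimalB (L : List ℕ) : Bool := q6.all fun q => decide (msk L ≤ msk (L.map (actCode 0 q)))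

/-- The slice (`0, 1, 2`) to which the `(n+1)`-st code belongs, for slice quotas `n₀` and `n₀ + n₁ = n01`. [folklore] -/
def sliceOf (n0 n01 n : ℕ) : ℕ := if n < n0 then 0 else if n < n01 then 1 else 2

/-- Where the child's scan starts: at `0` when it opens a new slice, else just after the parent's candidate. [folklore] -/
def nextStart (n0 n01 n t : ℕ) : ℕ := if n + 1 = n0 ∨ n + 1 = n01 then 0 else t + 1

/-- The candidate filter at a node: alive in the pair mask, no cap violation (if `cap`), and Q6-minimal when it completes slice 0. [folklore] -/
def passB (n0 : ℕ) (cap : Bool) (P n A r : ℕ) : Bool :=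
  A.testBit r && !(cap && capViol P n r) && !(n + 1 == n0 && !minimalB (codesOf (r ||| (P <<< 7)) (n + 1)))

/-- The witness branch: the next 48 stream bits refute the candidate list. [folklore] -/
def witB (P n r X : ℕ) : Bool :=
  validWit (n + 1) (X / 2 % 2 ^ 48) && refWP false (n + 1) (r ||| (P <<< 7)) (X / 2 % 2 ^ 48)

/-- Scan the candidates `t, …, t + k − 1` of the current slice at the node `(P, n, A)` (packed codes, their number, alive mask), consuming
the stream `X`; `child` is the recursive call.  `none` = the certificate fails. [folklore] -/
def scanF (GT n0 n01 : ℕ) (cap : Bool) (child : ℕ → ℕ → ℕ → ℕ → ℕ → Option ℕ) (P n A : ℕ) : ℕ → ℕ → ℕ → Option ℕ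
  | 0, _, X => some X
  | k + 1, t, X =>
    if passB n0 cap P n A (27 * sliceOf n0 n01 n + t) then
      (if X % 2 = 1 then
        (match child ((27 * sliceOf n0 n01 n + t) ||| (P <<< 7)) (n + 1) (A &&& goodRow GT (27 * sliceOf n0 n01 n + t))
            (nextStart n0 n01 n t) (X / 2) with
          | none => none
          | some X' => scanF GT n0 n01 cap child P n A k (t + 1) X')
       else if witB P n (27 * sliceOf n0 n01 n + t) X then scanF GT n0 n01 cap child P n A k (t + 1) (X / 2 / 2 ^ 48)
       else none)
    else scanF GT n0 n01 cap child P n A k (t + 1) X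

/-- The node: fails at 8 codes, otherwise scans its slice from `start`. `fuel` bounds the depth. [folklore] -/
def nodeF (GT n0 n01 : ℕ) (cap : Bool) : ℕ → ℕ → ℕ → ℕ → ℕ → ℕ → Option ℕ
  | 0, _, _, _, _, _ => none
  | fuel + 1, P, n, A, start, X =>
    if 8 ≤ n then none else scanF GT n0 n01 cap (nodeF GT n0 n01 cap fuel) P n A (27 - start) start X

/-- The top-level run for first codes `a, …, a + k − 1` (empty node, full alive mask): the stream must be consumed down to the sentinel `1`.
[folklore] -/
def topRun (GT n0 n01 : ℕ) (cap : Bool) (a k X : ℕ) : Bool :=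
  scanF GT n0 n01 cap (nodeF GT n0 n01 cap 8) 0 0 (2 ^ 81 - 1) k a X == some 1

end W4

end Summit.MatrixMultiplication.OmegaCensus
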